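import Mathlib.RingTheory.DedekindDomain.Factorization
import Mathlib.RingTheory.Ideal.Norm.AbsNorm
import Mathlib.NumberTheory.NumberField.Basic
import Mathlib.Analysis.SpecialFunctions.Pow.NNReal
import Mathlib.RingTheory.Coprime.Lemmas
import HarnessLib

/-!
# `∏_{𝔭 ∣ 𝔪} (1 − N(𝔭)⁻¹) ≫_δ N(𝔪)^{−δ}` for the ideals of a number field

Topic `Literature/NumberTheory/LFunctions`; the number-field analogue of the weak form of Montgomery–Vaughan,
Theorem 2.9 used in `SiegelTheorem.lean` for `K = ℚ` (`Siegel.exists_prod_one_sub_inv_ge`: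
`∏_{p ∣ n}(1 − 1/p) ≫_ε n^{−ε}`). Everything here is PROVED (theorems only).

For a number field `K`, a nonzero ideal `𝔪` of `𝓞 K` and `T(𝔪)` the finite set of primes dividing `𝔪`
(Mathlib `Ideal.finite_factors`):

* `prod_absNorm_le_absNorm` — `∏_{𝔭 ∈ T(𝔪)} N(𝔭) ≤ N(𝔪)` (the radical divides `𝔪`: distinct maximal ideals
  are pairwise coprime, Mathlib `Finset.prod_dvd_of_coprime`, and `Ideal.absNorm_dvd_absNorm_of_le`);
* `exists_prod_one_sub_inv_absNorm_ge` — **for every `δ > 0` there is `C > 0` with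
  `C · N(𝔪)^{−δ} ≤ ∏_{𝔭 ∈ T(𝔪)} (1 − N(𝔭)⁻¹)` for all `𝔪 ≠ 0`.** Proof: with `y = max(2, 2^{1/δ})`, a prime
  with `N(𝔭) ≥ y` has `1 − N(𝔭)⁻¹ ≥ ½ ≥ N(𝔭)^{−δ}`, so the primes of `T(𝔪)` with `N(𝔭) ≥ y` contribute at
  least `(∏ N(𝔭))^{−δ} ≥ N(𝔪)^{−δ}`; the finitely many primes of `K` with `N(𝔭) < y` contribute at least the
  constant `C = ∏_{N(𝔭) < y}(1 − N(𝔭)⁻¹) > 0`.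

**Purpose.** The clause `principal_case` of the abstract Siegel theorem (`SiegelFamilyData`,
`SiegelTheoremAbstract.lean`) for ray class characters of `K`: when `χ_iχ_j` is principal, `L(s, χ_i)` and
`L(s, χ_j)` differ by the Euler factors at the primes dividing `𝔪_i𝔪_j`, each between `1 − N(𝔭)⁻¹` and
`(1 − N(𝔭)⁻¹)⁻¹` at `s = 1`.

## References

* H. L. Montgomery, R. C. Vaughan, *Multiplicative Number Theory I*, CUP 2007, Theorem 2.9 and §11.2 p. 285.
  [cite: MontgomeryVaughan2007, Theorem 2.9]

## Mathlib / tree search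

Mathlib: `Ideal.finite_factors`, `Ideal.finite_setOf_absNorm_le`, `Finset.prod_dvd_of_coprime`,
`Ideal.IsMaximal.coprime_of_ne`, `Ideal.absNorm_dvd_absNorm_of_le`, `Real.finsetProd_rpow`.
Tree: `Siegel.exists_prod_one_sub_inv_ge` (`SiegelTheorem.lean`, `K = ℚ`); nothing for ideals
(`lean search 'prod_one_sub_inv_absNorm|radical.*absNorm' --decl`).
-/

noncomputable section

open Finset IsDedekindDomain NumberField

namespace Literature.NumberTheory.LFunctions

variable {K : Type*} [Field K] [NumberField K]

/-- The finite set `T(𝔪)` of primes dividing the nonzero ideal `𝔪`. [folklore] -/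
theorem mem_primeDivisors_toFinset {𝔪 : Ideal (𝓞 K)} (h𝔪 : 𝔪 ≠ ⊥) {v : HeightOneSpectrum (𝓞 K)} :
    v ∈ (Ideal.finite_factors h𝔪).toFinset ↔ v.asIdeal ∣ 𝔪 := by
  simp

/-- **The radical divides**: `∏_{𝔭 ∈ T(𝔪)} N(𝔭) ≤ N(𝔪)` (indeed `∏ 𝔭 ∣ 𝔪`). [folklore] -/
theorem prod_absNorm_le_absNorm {𝔪 : Ideal (𝓞 K)} (h𝔪 : 𝔪 ≠ ⊥) {T : Finset (HeightOneSpectrum (𝓞 K))}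
    (hT : ∀ v ∈ T, v.asIdeal ∣ 𝔪) : ∏ v ∈ T, Ideal.absNorm v.asIdeal ≤ Ideal.absNorm 𝔪 := by
  have hcop : (T : Set (HeightOneSpectrum (𝓞 K))).Pairwise
      (Function.onFun IsCoprime fun v : HeightOneSpectrum (𝓞 K) => v.asIdeal) := by
    intro v _ w _ hvw
    have hne : v.asIdeal ≠ w.asIdeal := fun h => hvw (HeightOneSpectrum.ext h)
    exact Ideal.isCoprime_iff_sup_eq.mpr (v.isMaximal.coprime_of_ne w.isMaximal hne)
  have hdvd : (∏ v ∈ T, v.asIdeal) ∣ 𝔪 := Finset.prod_dvd_of_coprime hcop hT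
  have hN : Ideal.absNorm 𝔪 ≠ 0 := by rwa [Ne, Ideal.absNorm_eq_zero_iff]
  have h := Ideal.absNorm_dvd_absNorm_of_le (Ideal.le_of_dvd hdvd)
  rw [map_prod] at h
  exact Nat.le_of_dvd (Nat.pos_of_ne_zero hN) h

/-- The primes of `K` of norm `< y` form a finite set. [folklore] -/
theorem finite_setOf_absNorm_asIdeal_lt (y : ℝ) :
    {v : HeightOneSpectrum (𝓞 K) | (Ideal.absNorm v.asIdeal : ℝ) < y}.Finite := by
  have h1 : ((fun v : HeightOneSpectrum (𝓞 K) => v.asIdeal) ⁻¹'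
      {I : Ideal (𝓞 K) | Ideal.absNorm I ≤ ⌈y⌉₊}).Finite :=
    (Ideal.finite_setOf_absNorm_le ⌈y⌉₊).preimage fun v _ w _ h => HeightOneSpectrum.ext h
  refine h1.subset fun v hv => ?_
  simp only [Set.mem_setOf_eq] at hv
  simp only [Set.mem_preimage, Set.mem_setOf_eq]
  have : (Ideal.absNorm v.asIdeal : ℝ) ≤ ⌈y⌉₊ := hv.le.trans (Nat.le_ceil y)
  exact_mod_cast this

/-- **`∏_{𝔭 ∣ 𝔪}(1 − N(𝔭)⁻¹) ≫_δ N(𝔪)^{−δ}`** (number-field form of the weak MV Theorem 2.9): for every `δ > 0`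
there is `C > 0` such that for every nonzero ideal `𝔪` of `𝓞 K`,
`C · N(𝔪)^{−δ} ≤ ∏_{𝔭 ∈ T(𝔪)} (1 − N(𝔭)⁻¹)`. [cite: MontgomeryVaughan2007, Theorem 2.9] -/
theorem exists_prod_one_sub_inv_absNorm_ge {δ : ℝ} (hδ : 0 < δ) :
    ∃ C : ℝ, 0 < C ∧ ∀ (𝔪 : Ideal (𝓞 K)) (h𝔪 : 𝔪 ≠ ⊥),
      C * (Ideal.absNorm 𝔪 : ℝ) ^ (-δ) ≤
        ∏ v ∈ (Ideal.finite_factors h𝔪).toFinset, (1 - ((Ideal.absNorm v.asIdeal : ℝ))⁻¹) := by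
  classical
  -- `N(𝔭) ≥ 2` (the tree's `AbelianDensity.two_le_absNorm`, not imported here)
  have two_le_absNorm_asIdeal : ∀ v : HeightOneSpectrum (𝓞 K), 2 ≤ Ideal.absNorm v.asIdeal := by
    intro v
    have h0 : Ideal.absNorm v.asIdeal ≠ 0 := by
      rw [Ne, Ideal.absNorm_eq_zero_iff]; exact v.ne_bot
    have h1 : Ideal.absNorm v.asIdeal ≠ 1 := by
      rw [Ne, Ideal.absNorm_eq_one_iff]; exact v.isPrime.ne_top
    omega
  -- the threshold `y = max 2 (2^{1/δ})`: for `N ≥ y`, `1 − 1/N ≥ 1/2 ≥ N^{-δ}`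
  set y : ℝ := max 2 ((2 : ℝ) ^ (1 / δ)) with hy
  have hy2 : 2 ≤ y := le_max_left _ _
  have hkey : ∀ N : ℝ, y ≤ N → N ^ (-δ) ≤ 1 - N⁻¹ := by
    intro N hN
    have hN0 : 0 < N := by linarith
    have h1 : N ^ (-δ) ≤ 1 / 2 := by
      have h2δ : (2 : ℝ) ^ (1 / δ) ≤ N := (le_max_right _ _).trans hN
      have : N ^ (-δ) ≤ ((2 : ℝ) ^ (1 / δ)) ^ (-δ) :=
        Real.rpow_le_rpow_of_nonpos (by positivity) h2δ (by linarith)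
      rw [← Real.rpow_mul (by norm_num), show (1 / δ) * (-δ) = -1 by field_simp] at this
      rw [Real.rpow_neg_one] at this
      linarith
    have h2 : N⁻¹ ≤ 1 / 2 := by rw [inv_le_comm₀ hN0 (by norm_num)]; linarith
    linarith
  -- the constant: the product over the primes of norm `< y`
  set S : Finset (HeightOneSpectrum (𝓞 K)) := (finite_setOf_absNorm_asIdeal_lt (K := K) y).toFinset with hS
  have hmemS : ∀ v, v ∈ S ↔ (Ideal.absNorm v.asIdeal : ℝ) < y := fun v => by simp [hS]
  have hfac_pos : ∀ v : HeightOneSpectrum (𝓞 K), 0 < 1 - ((Ideal.absNorm v.asIdeal : ℝ))⁻¹ := by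
    intro v
    have h2 : (2 : ℝ) ≤ Ideal.absNorm v.asIdeal := by exact_mod_cast two_le_absNorm_asIdeal v
    have : ((Ideal.absNorm v.asIdeal : ℝ))⁻¹ ≤ 1 / 2 := by
      rw [inv_le_comm₀ (by linarith) (by norm_num)]; linarith
    linarith
  have hfac_le : ∀ v : HeightOneSpectrum (𝓞 K), 1 - ((Ideal.absNorm v.asIdeal : ℝ))⁻¹ ≤ 1 := fun v => by
    have : 0 ≤ ((Ideal.absNorm v.asIdeal : ℝ))⁻¹ := by positivity
    linarith
  set C : ℝ := ∏ v ∈ S, (1 - ((Ideal.absNorm v.asIdeal : ℝ))⁻¹) with hC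
  have hCpos : 0 < C := Finset.prod_pos fun v _ => hfac_pos v
  refine ⟨C, hCpos, fun 𝔪 h𝔪 => ?_⟩
  set T := (Ideal.finite_factors h𝔪).toFinset with hT
  have hTdvd : ∀ v ∈ T, v.asIdeal ∣ 𝔪 := fun v hv => (mem_primeDivisors_toFinset h𝔪).mp hv
  -- split `T` into small and large primes
  set T₁ := T.filter fun v => (Ideal.absNorm v.asIdeal : ℝ) < y with hT₁
  set T₂ := T.filter fun v => ¬ (Ideal.absNorm v.asIdeal : ℝ) < y with hT₂
  have hsplit : ∏ v ∈ T, (1 - ((Ideal.absNorm v.asIdeal : ℝ))⁻¹) =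
      (∏ v ∈ T₁, (1 - ((Ideal.absNorm v.asIdeal : ℝ))⁻¹)) * ∏ v ∈ T₂, (1 - ((Ideal.absNorm v.asIdeal : ℝ))⁻¹) :=
    (Finset.prod_filter_mul_prod_filter_not T _ _).symm
  -- small primes: at least `C`
  have h1 : C ≤ ∏ v ∈ T₁, (1 - ((Ideal.absNorm v.asIdeal : ℝ))⁻¹) := by
    have hsub : T₁ ⊆ S := fun v hv => by
      rw [hT₁, Finset.mem_filter] at hv
      exact (hmemS v).mpr hv.2
    rw [hC, ← Finset.prod_sdiff hsub]
    have hle1 : ∏ v ∈ S \ T₁, (1 - ((Ideal.absNorm v.asIdeal : ℝ))⁻¹) ≤ 1 :=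
      Finset.prod_le_one (fun v _ => (hfac_pos v).le) fun v _ => hfac_le v
    have hnn : 0 ≤ ∏ v ∈ T₁, (1 - ((Ideal.absNorm v.asIdeal : ℝ))⁻¹) :=
      Finset.prod_nonneg fun v _ => (hfac_pos v).le
    nlinarith
  -- large primes: at least `(∏ N)^{-δ} ≥ N(𝔪)^{-δ}`
  have h2 : (Ideal.absNorm 𝔪 : ℝ) ^ (-δ) ≤ ∏ v ∈ T₂, (1 - ((Ideal.absNorm v.asIdeal : ℝ))⁻¹) := by
    have hT₂sub : ∀ v ∈ T₂, v.asIdeal ∣ 𝔪 := fun v hv => hTdvd v (Finset.mem_of_mem_filter v hv)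
    have hprodle : ((∏ v ∈ T₂, Ideal.absNorm v.asIdeal : ℕ) : ℝ) ≤ (Ideal.absNorm 𝔪 : ℝ) := by
      exact_mod_cast prod_absNorm_le_absNorm h𝔪 hT₂sub
    have hprodpos : 0 < ((∏ v ∈ T₂, Ideal.absNorm v.asIdeal : ℕ) : ℝ) := by
      rw [Nat.cast_pos]
      exact Finset.prod_pos fun v _ => lt_of_lt_of_le zero_lt_two (two_le_absNorm_asIdeal v)
    calc (Ideal.absNorm 𝔪 : ℝ) ^ (-δ) ≤ ((∏ v ∈ T₂, Ideal.absNorm v.asIdeal : ℕ) : ℝ) ^ (-δ) :=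
          Real.rpow_le_rpow_of_nonpos hprodpos hprodle (by linarith)
      _ = ∏ v ∈ T₂, (Ideal.absNorm v.asIdeal : ℝ) ^ (-δ) := by
          rw [Nat.cast_prod, Real.finsetProd_rpow _ _ fun v _ => (Nat.cast_nonneg _)]
      _ ≤ ∏ v ∈ T₂, (1 - ((Ideal.absNorm v.asIdeal : ℝ))⁻¹) := by
          refine Finset.prod_le_prod (fun v _ => Real.rpow_nonneg (Nat.cast_nonneg _) _) fun v hv => ?_
          rw [hT₂, Finset.mem_filter, not_lt] at hv
          exact hkey _ hv.2
  rw [hsplit]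
  have hnn2 : 0 ≤ (Ideal.absNorm 𝔪 : ℝ) ^ (-δ) := Real.rpow_nonneg (Nat.cast_nonneg _) _
  exact mul_le_mul h1 h2 hnn2 (Finset.prod_nonneg fun v _ => (hfac_pos v).le)

end Literature.NumberTheory.LFunctions

end
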